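import Summits.ABC.IUTFork.Thm311RealInd1StripGlobalStrictness
import HarnessLib

/-!
# [IUTchIII] Thm 3.11 (i) (Ind1)+(Ind2) ⟶ Cor 3.12, GLOBAL level, IDENTITY SIDE (reading (P)): the nonarchimedean Θ-side over print's (Ind1)⊔(Ind2)
# AS TYPED equals Dupuy–Hilado's `−|log(Θ)|^{(P),nonarch}` iff it does so PRIME BY PRIME over `T(I)`; at a tame support prime `p > 2` of odd local degree
# `≥ 3` this happens iff every collection has room (⟹ UNCONDITIONAL, ⟸ mod `JannsenWingbergMappingClass`); so the global identity is LOCALISED at the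
# residual support primes — `p = 2` (always in `T(I)`), the wild and the even-degree ones

PROOF-ONLY file (abc-iut cell, Cor. 3.12 sub-crew, seat abc-iut-c312-1 = holder of record of the typed [IUTchIII] Thm. 3.11, gen 23; offer (τ)
«C:GLOBAL-IDENTITY-LOCALISATION», file 1 of 2, sequel of row R31 `Thm311RealInd1StripGlobalStrictness` (p588683)).  TAKES NO SIDE on [IUTchIII] Cor. 3.12.
No definition, no `Prop` fact.  `JannsenWingbergMappingClass` enters ONLY §3 (identity side); §1, §2, §4 UNCONDITIONAL, and §2's ⟹ theorem carries NO
parity / bit-witness / strip-move binder (abc-iut-L5-t8 g41's `hMC`-deletion probe on p587766, answered at the global level).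

SETTING (as p588683): a genuine Θ-volume input `I : ThetaVolumeInput F₀ K` (support primes `T(I) ∋ 2`, `negLogThetaPerImageNonarch I = Σ_{p∈T(I)}
negLogThetaPerImageLoc I p`, claim form `Cor312PerImageNonarchOf I`) and a PRIME-INDEXED family `H = (H_{p,j,v⃗}) ≤ indTwo`; «the nonarchimedean Θ-side
over `H`» (reading (P)) is INLINE: `Σ_{p∈T(I)} [p prime] ln ν̄_{𝕃_p}(v⃗ ↦ hull(⋃_{g∈H_{p,v⃗}} g(O_𝕃(−P_Θ)_{v⃗})))`.
* §1 PRIME-BY-PRIME REDUCTION (UNCONDITIONAL): **`sum_lnνLp_hull_orbitH_eq_negLogThetaPerImageNonarch_iff_forall_eq`** — the `H`-sum equals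
  `negLogThetaPerImageNonarch I` iff every guarded summand equals `negLogThetaPerImageLoc I p` (`Finset.sum_eq_sum_iff_of_le` over p588683 §1); hence
  **`lnνLp_hull_orbitH_eq_negLogThetaPerImageLoc_of_sum_eq`** at every support prime and **`…_two_of_sum_eq`** at `p = 2`, which is ALWAYS a support prime
  (`two_mem_supportPrimes`) and outside every R-row (`e(v̲|p) ≤ p − 2` is empty there).
* §2 ⟹ (UNCONDITIONAL, no `hMC`, no parity, no bit witness, no strip move): **`forall_room_of_sum_lnνLp_hull_orbitH_eq_negLogThetaPerImageNonarch`** — the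
  global identity forces, at every support prime `p₀ > 2` whose section places are tame with no place of local degree one, EVERY collection to pass its room
  test at the twisted slot (bit oracle read through `hfix` only; contrapositive of p588683 §3 after p587766's `S`-conversion).
* §3 ⟸ ON A PRIME SET (mod `JannsenWingbergMappingClass`): **`dif_lnνLp_hull_orbitH_eq_negLogThetaPerImageLoc_of_forall_room_…`** (one tame support
  prime of odd local degree `≥ 3`, all-room ⟹ summand identity; p588176 §1) and the LOCALISATION
  **`sum_lnνLp_hull_orbitH_eq_negLogThetaPerImageNonarch_iff_forall_eq_sdiff_of_forall_room_…`**: for `P ⊆ T(I)` passing as above, the GLOBAL identity ⟺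
  the summand identity on the RESIDUAL support primes `T(I) \ P` (which contains `2`, `two_mem_supportPrimes_sdiff`).
* §4 CLAIM FORMS: **`negAbsLogQ_le_sum_iff_cor312PerImageNonarchOf_of_sum_eq`** — on the identity locus «Cor 3.12's (P)-form over `H`» ⟺ `Cor312PerImageNonarchOf I`
  (with p588683 §4: equivalent ON the locus, a tighter bound OFF it).
READING (numbers about OUR typed objects; neutral): R31 priced the failure branch globally; this file says where the identity branch LIVES.  Since `2 ∈ T(I)`
for every input (and every prime ramified in `K` is in `T(I)`), «the `H`-side equals Dupuy–Hilado's number» is never settled by the tame-odd rows alone: at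
an input all of whose tame-odd support primes pass it is EQUIVALENT to the summand identities at `p = 2`, at the wild and at the even-degree support primes —
nothing is claimed there; which value a bit takes is NOT claimed.  HONEST SCOPE: OUR typings (THE equivariant lift, THE logarithm, factorwise action);
equal-AS-TYPED ≠ equal in print; nothing here asserts that abc is proved or refuted; no side taken on [IUTchIII] Cor. 3.12 / [IUTchIV] Thm. 1.10, on (U)
vs (P), or on any author. [claim: Mochizuki2012, status: disputed]; [cite: Mochizuki2012, IUTchIII Thm. 3.11 (i) p. 154; Cor. 3.12 pp. 173–174, Steps
(x)/(xi) pp. 181–183; IUTchIV Thm. 1.10 Steps (v)–(viii) pp. 27–31, Prop. 1.4 (iii) p. 13]; [cite: DupuyHilado2025, §1 (1.1), Def. 3.6.3, §3.9, §4.9,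
§4.12]. typed ≠ proved; a conditional theorem discharges nothing it binds.
-/

set_option autoImplicit false

noncomputable section

open Metric Set Function Module
open scoped Pointwise TensorProduct

namespace Literature.IUT.LogVolume.ThetaVolumeInput

open Summit.ABC.IUTFork.Thm311.Real Literature.NumberTheory.NumberFields Function
open Literature.NumberTheory.GaloisRepresentations Literature.NumberTheory.GaloisRepresentations.Ultrametric
open Literature.AnabelianGeometry.AbsoluteAnabelian Literature.IUT.HodgeArakelov
open Literature.IUT.HodgeArakelov.AbsTopMonoids NumberField IsDedekindDomain

variable {F₀ : Type} [Field F₀] [NumberField F₀] {K : Type} [Field K] [NumberField K] [Algebra F₀ K]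
variable (I : ThetaVolumeInput F₀ K)

/-- **PRIME-BY-PRIME REDUCTION, reading (P) (UNCONDITIONAL).**  For ANY prime-indexed family `H ≤ indTwo`, the nonarchimedean Θ-side over `H` EQUALS
`−|log(Θ)|^{(P),nonarch}` iff its guarded `p`-summand equals `negLogThetaPerImageLoc I p` at EVERY support prime `p ∈ T(I)` — a sum of termwise `≤`
(p588683 §1) is an equality iff every term is (`Finset.sum_eq_sum_iff_of_le`). [claim: Mochizuki2012, status: disputed]
[cite: Mochizuki2012, IUTchIII Cor. 3.12 proof Step (x) p. 181; IUTchIV Thm. 1.10 Step (viii) p. 31] [cite: DupuyHilado2025, §1 (1.1), Def. 3.6.3, §4.12] -/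
theorem sum_lnνLp_hull_orbitH_eq_negLogThetaPerImageNonarch_iff_forall_eq
    (H : ∀ (p : ℕ) (hp : p.Prime), haveI : Fact p.Prime := ⟨hp⟩
      (j : ℕ) → (e : Fin (j + 1) → placesOver F₀ p) →
        Subgroup (PacketAlgebra p (fun b => (I.σ.localFields p).k (e b)) ≃ₗ[ℚ_[p]]
          PacketAlgebra p (fun b => (I.σ.localFields p).k (e b))))
    (hH : ∀ (p : ℕ) (hp : p.Prime), haveI : Fact p.Prime := ⟨hp⟩; ∀ j e, H p hp j e ≤ indTwo p (fun b => (I.σ.localFields p).k (e b))) :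
    (∑ p ∈ I.supportPrimes, if hp : p.Prime then
        (haveI : Fact p.Prime := ⟨hp⟩
        (I.packetAt p hp).lnνLp I.lstar (fun j e =>
          packetHull p (fun b => (I.σ.localFields p).k (e b))
            (⋃ g : H p hp j e, (g : PacketAlgebra p (fun b => (I.σ.localFields p).k (e b)) ≃ₗ[ℚ_[p]]
                PacketAlgebra p (fun b => (I.σ.localFields p).k (e b))) ''
              (I.packetAt p hp).pilotRegion (I.tΘ p hp) j e))) else 0) =
      I.negLogThetaPerImageNonarch ↔
    ∀ p ∈ I.supportPrimes, (if hp : p.Prime then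
        (haveI : Fact p.Prime := ⟨hp⟩
        (I.packetAt p hp).lnνLp I.lstar (fun j e =>
          packetHull p (fun b => (I.σ.localFields p).k (e b))
            (⋃ g : H p hp j e, (g : PacketAlgebra p (fun b => (I.σ.localFields p).k (e b)) ≃ₗ[ℚ_[p]]
                PacketAlgebra p (fun b => (I.σ.localFields p).k (e b))) ''
              (I.packetAt p hp).pilotRegion (I.tΘ p hp) j e))) else 0) =
      I.negLogThetaPerImageLoc p := by
  unfold negLogThetaPerImageNonarch
  refine Finset.sum_eq_sum_iff_of_le fun p hpT => ?_
  have hp : p.Prime := I.prime_of_mem_supportPrimes hpT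
  rw [dif_pos hp]
  exact I.lnνLp_hull_orbitH_le_negLogThetaPerImageLoc hp (H p hp) (hH p hp)

/-- **At every support prime the global identity forces the summand identity (UNCONDITIONAL).**  If the nonarchimedean Θ-side over `H ≤ indTwo` equals
`−|log(Θ)|^{(P),nonarch}`, then `ln ν̄_{𝕃_p}(reading (P) over H_p) = negLogThetaPerImageLoc I p` at every `p ∈ T(I)`. [claim: Mochizuki2012, status: disputed]
[cite: Mochizuki2012, IUTchIII Cor. 3.12 proof Step (x) p. 181] [cite: DupuyHilado2025, Def. 3.6.3, §4.12] -/
theorem lnνLp_hull_orbitH_eq_negLogThetaPerImageLoc_of_sum_eq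
    (H : ∀ (p : ℕ) (hp : p.Prime), haveI : Fact p.Prime := ⟨hp⟩
      (j : ℕ) → (e : Fin (j + 1) → placesOver F₀ p) →
        Subgroup (PacketAlgebra p (fun b => (I.σ.localFields p).k (e b)) ≃ₗ[ℚ_[p]]
          PacketAlgebra p (fun b => (I.σ.localFields p).k (e b))))
    (hH : ∀ (p : ℕ) (hp : p.Prime), haveI : Fact p.Prime := ⟨hp⟩; ∀ j e, H p hp j e ≤ indTwo p (fun b => (I.σ.localFields p).k (e b)))
    (hEq : (∑ p ∈ I.supportPrimes, if hp : p.Prime then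
        (haveI : Fact p.Prime := ⟨hp⟩
        (I.packetAt p hp).lnνLp I.lstar (fun j e =>
          packetHull p (fun b => (I.σ.localFields p).k (e b))
            (⋃ g : H p hp j e, (g : PacketAlgebra p (fun b => (I.σ.localFields p).k (e b)) ≃ₗ[ℚ_[p]]
                PacketAlgebra p (fun b => (I.σ.localFields p).k (e b))) ''
              (I.packetAt p hp).pilotRegion (I.tΘ p hp) j e))) else 0) =
      I.negLogThetaPerImageNonarch)
    {p : ℕ} (hpT : p ∈ I.supportPrimes) (hp : p.Prime) :
    haveI : Fact p.Prime := ⟨hp⟩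
    (I.packetAt p hp).lnνLp I.lstar (fun j e =>
        packetHull p (fun b => (I.σ.localFields p).k (e b))
          (⋃ g : H p hp j e, (g : PacketAlgebra p (fun b => (I.σ.localFields p).k (e b)) ≃ₗ[ℚ_[p]]
              PacketAlgebra p (fun b => (I.σ.localFields p).k (e b))) ''
            (I.packetAt p hp).pilotRegion (I.tΘ p hp) j e)) =
      I.negLogThetaPerImageLoc p := by
  have h := (I.sum_lnνLp_hull_orbitH_eq_negLogThetaPerImageNonarch_iff_forall_eq H hH).mp hEq p hpT
  rw [dif_pos hp] at h
  exact h

/-- **The global identity is decided ALSO at `p = 2` (UNCONDITIONAL).**  `2 ∈ T(I)` for every input (`two_mem_supportPrimes`), so the global identity forces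
`ln ν̄_{𝕃_2}(reading (P) over H_2) = negLogThetaPerImageLoc I 2`; no R-row speaks about this summand (`e(v̲|p) ≤ p − 2` has no solution at `p = 2`).
[claim: Mochizuki2012, status: disputed] [cite: Mochizuki2012, IUTchIV Thm. 1.10 Step (vi) p. 29; IUTchIII Cor. 3.12 proof Step (x) p. 181]
[cite: DupuyHilado2025, §3.9, Def. 3.6.3] -/
theorem lnνLp_hull_orbitH_eq_negLogThetaPerImageLoc_two_of_sum_eq
    (H : ∀ (p : ℕ) (hp : p.Prime), haveI : Fact p.Prime := ⟨hp⟩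
      (j : ℕ) → (e : Fin (j + 1) → placesOver F₀ p) →
        Subgroup (PacketAlgebra p (fun b => (I.σ.localFields p).k (e b)) ≃ₗ[ℚ_[p]]
          PacketAlgebra p (fun b => (I.σ.localFields p).k (e b))))
    (hH : ∀ (p : ℕ) (hp : p.Prime), haveI : Fact p.Prime := ⟨hp⟩; ∀ j e, H p hp j e ≤ indTwo p (fun b => (I.σ.localFields p).k (e b)))
    (hEq : (∑ p ∈ I.supportPrimes, if hp : p.Prime then
        (haveI : Fact p.Prime := ⟨hp⟩
        (I.packetAt p hp).lnνLp I.lstar (fun j e =>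
          packetHull p (fun b => (I.σ.localFields p).k (e b))
            (⋃ g : H p hp j e, (g : PacketAlgebra p (fun b => (I.σ.localFields p).k (e b)) ≃ₗ[ℚ_[p]]
                PacketAlgebra p (fun b => (I.σ.localFields p).k (e b))) ''
              (I.packetAt p hp).pilotRegion (I.tΘ p hp) j e))) else 0) =
      I.negLogThetaPerImageNonarch) :
    haveI : Fact (2 : ℕ).Prime := ⟨Nat.prime_two⟩
    (I.packetAt 2 Nat.prime_two).lnνLp I.lstar (fun j e =>
        packetHull 2 (fun b => (I.σ.localFields 2).k (e b))
          (⋃ g : H 2 Nat.prime_two j e, (g : PacketAlgebra 2 (fun b => (I.σ.localFields 2).k (e b)) ≃ₗ[ℚ_[2]]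
              PacketAlgebra 2 (fun b => (I.σ.localFields 2).k (e b))) ''
            (I.packetAt 2 Nat.prime_two).pilotRegion (I.tΘ 2 Nat.prime_two) j e)) =
      I.negLogThetaPerImageLoc 2 :=
  I.lnνLp_hull_orbitH_eq_negLogThetaPerImageLoc_of_sum_eq H hH hEq I.two_mem_supportPrimes Nat.prime_two

/-- **GLOBAL IDENTITY ⟹ ALL-ROOM AT EVERY TAME SUPPORT PRIME (UNCONDITIONAL; no `JannsenWingbergMappingClass`, no parity, no bit witness, no strip move).**
Let the nonarchimedean Θ-side over a prime-indexed `H ≤ indTwo` EQUAL `−|log(Θ)|^{(P),nonarch}`.  Then at every support prime `p₀ > 2` over which every place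
of the section is tame (`e(v̲|p₀) ≤ p₀ − 2`) of local degree `≥ 2`, for every valuation family `‖t_{i,v_last}‖ = p₀^{−v(i,v⃗)/e}`, every bit oracle `bit` with
`hfix` at the residue-degree-one places it leaves off, and `H_{p₀,v⃗}` factorwise through the realised strip groups, EVERY collection `(i, v⃗)` satisfies
`((v(i,v⃗)−1) % e + 1)/e + Σ_{b : f(v̲_b|p₀) = 1 ∧ ¬bit(v_b)} 1/e(v̲_b|p₀) ≤ 1` — a failing collection would make the sum STRICTLY smaller (p588683 §3 after
p587766's `S`-conversion). [claim: Mochizuki2012, status: disputed] [cite: Mochizuki2012, IUTchIII Thm. 3.11 (i) p. 154; Cor. 3.12 proof Step (x) p. 181;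
IUTchIV Prop. 1.4 (iii) p. 13] [cite: DupuyHilado2025, §1 (1.1), Def. 3.6.3, §4.9, §4.12] -/
theorem forall_room_of_sum_lnνLp_hull_orbitH_eq_negLogThetaPerImageNonarch
    (H : ∀ (p : ℕ) (hp : p.Prime), haveI : Fact p.Prime := ⟨hp⟩
      (j : ℕ) → (e : Fin (j + 1) → placesOver F₀ p) →
        Subgroup (PacketAlgebra p (fun b => (I.σ.localFields p).k (e b)) ≃ₗ[ℚ_[p]]
          PacketAlgebra p (fun b => (I.σ.localFields p).k (e b))))
    (hH : ∀ (p : ℕ) (hp : p.Prime), haveI : Fact p.Prime := ⟨hp⟩; ∀ j e, H p hp j e ≤ indTwo p (fun b => (I.σ.localFields p).k (e b)))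
    (hEq : (∑ p ∈ I.supportPrimes, if hp : p.Prime then
        (haveI : Fact p.Prime := ⟨hp⟩
        (I.packetAt p hp).lnνLp I.lstar (fun j e =>
          packetHull p (fun b => (I.σ.localFields p).k (e b))
            (⋃ g : H p hp j e, (g : PacketAlgebra p (fun b => (I.σ.localFields p).k (e b)) ≃ₗ[ℚ_[p]]
                PacketAlgebra p (fun b => (I.σ.localFields p).k (e b))) ''
              (I.packetAt p hp).pilotRegion (I.tΘ p hp) j e))) else 0) =
      I.negLogThetaPerImageNonarch)
    {p₀ : ℕ} (hp₀T : p₀ ∈ I.supportPrimes) (hp₀ : p₀.Prime) (hp2 : 2 < p₀)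
    (he : haveI : Fact p₀.Prime := ⟨hp₀⟩; ∀ w : placesOver F₀ p₀, absRamificationIdx p₀ ((I.σ.localFields p₀).k w) ≤ p₀ - 2)
    (h2 : haveI : Fact p₀.Prime := ⟨hp₀⟩; ∀ w : placesOver F₀ p₀, 2 ≤ localDeg K (I.σ.lift w.1))
    (v : (i : Fin I.lstar) → (Fin ((i : ℕ) + 1 + 1) → placesOver F₀ p₀) → ℤ)
    (hv : haveI : Fact p₀.Prime := ⟨hp₀⟩; ∀ (i : Fin I.lstar) (e : Fin ((i : ℕ) + 1 + 1) → placesOver F₀ p₀),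
      ‖(I.tΘ p₀ hp₀ i (e (Fin.last _)) : (I.σ.localFieldFamily p₀ hp₀).k (e (Fin.last _)))‖ =
        (p₀ : ℝ) ^ (-(v i e / (absRamificationIdx p₀ ((I.σ.localFields p₀).k (e (Fin.last _))) : ℝ))))
    (bit : placesOver F₀ p₀ → Prop) [DecidablePred bit]
    (hfix : haveI : Fact p₀.Prime := ⟨hp₀⟩; ∀ w : placesOver F₀ p₀, (I.σ.lift w.1).asIdeal.inertiaDeg ℤ = 1 → ¬ bit w →
      ∀ ψ ∈ ind1StripOf (I.σ.lift w.1) (galoisLog (I.σ.lift w.1)),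
        RescaledCompletion.of K p₀ (I.σ.lift w.1) (I.σ.natCast_mem_lift w) (ψ (p₀ : (I.σ.lift w.1).adicCompletion K)) -
            (p₀ : RescaledCompletion K p₀ (I.σ.lift w.1) (I.σ.natCast_mem_lift w)) ∈
          (p₀ : ℚ_[p₀]) • logUnits (RescaledCompletion K p₀ (I.σ.lift w.1) (I.σ.natCast_mem_lift w)))
    (hHfac : haveI : Fact p₀.Prime := ⟨hp₀⟩
      ∀ (i : Fin I.lstar) (e : Fin ((i : ℕ) + 1 + 1) → placesOver F₀ p₀), ∀ γ ∈ H p₀ hp₀ ((i : ℕ) + 1) e,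
        ∃ δ : Π b, AddAut ((I.σ.lift (e b).1).adicCompletion K),
          (∀ b, δ b ∈ AddSubgroup.closure (G := AddAut ((I.σ.lift (e b).1).adicCompletion K))
            (ind1StripOf (I.σ.lift (e b).1) (galoisLog (I.σ.lift (e b).1)))) ∧
          ∀ z : Π b, (I.σ.localFields p₀).k (e b),
            (γ : PacketAlgebra p₀ (fun b => (I.σ.localFields p₀).k (e b)) ≃ₗ[ℚ_[p₀]]
                PacketAlgebra p₀ (fun b => (I.σ.localFields p₀).k (e b))) (PiTensorProduct.tprod ℚ_[p₀] z) =
              PiTensorProduct.tprod ℚ_[p₀] (fun b => RescaledCompletion.of K p₀ (I.σ.lift (e b).1) (I.σ.natCast_mem_lift (e b))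
                (δ b ((RescaledCompletion.of K p₀ (I.σ.lift (e b).1) (I.σ.natCast_mem_lift (e b))).symm (z b))))) :
    haveI : Fact p₀.Prime := ⟨hp₀⟩
    ∀ (i : Fin I.lstar) (e : Fin ((i : ℕ) + 1 + 1) → placesOver F₀ p₀),
      (((v i e - 1) % (absRamificationIdx p₀ ((I.σ.localFields p₀).k (e (Fin.last _))) : ℤ) + 1 : ℤ) : ℝ) /
          (absRamificationIdx p₀ ((I.σ.localFields p₀).k (e (Fin.last _))) : ℝ) +
        ∑ b ∈ Finset.univ \ Finset.univ.filter (fun b => (I.σ.lift (e b).1).asIdeal.inertiaDeg ℤ ≠ 1 ∨ bit (e b)),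
          (1 : ℝ) / (absRamificationIdx p₀ ((I.σ.localFields p₀).k (e b)) : ℝ) ≤ 1 := by
  haveI : Fact p₀.Prime := ⟨hp₀⟩
  classical
  intro i₁ e₁
  by_contra hnot
  -- the bit set of the collection `e₁` and what holds off it (p587766's conversion)
  set S : Finset (Fin ((i₁ : ℕ) + 1 + 1)) :=
    Finset.univ.filter (fun b => (I.σ.lift (e₁ b).1).asIdeal.inertiaDeg ℤ ≠ 1 ∨ bit (e₁ b)) with hS
  have hmemS : ∀ b, b ∈ S ↔ (I.σ.lift (e₁ b).1).asIdeal.inertiaDeg ℤ ≠ 1 ∨ bit (e₁ b) := fun b => by simp [hS]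
  have hfS : ∀ b, b ∉ S → (I.σ.lift (e₁ b).1).asIdeal.inertiaDeg ℤ = 1 := fun b hb => by
    by_contra h; exact hb ((hmemS b).mpr (Or.inl h))
  have hbS : ∀ b, b ∉ S → ¬ bit (e₁ b) := fun b hb hbit' => hb ((hmemS b).mpr (Or.inr hbit'))
  have he2 : ∀ b, b ∉ S → 2 ≤ absRamificationIdx p₀ ((I.σ.localFields p₀).k (e₁ b)) := fun b hb => by
    have h := h2 (e₁ b)
    rw [localDeg, hfS b hb, mul_one, ← absRamificationIdx_rescaledCompletion K p₀ (I.σ.lift (e₁ b).1) (I.σ.natCast_mem_lift (e₁ b))] at h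
    exact h
  have hlt := I.sum_lnνLp_hull_orbitH_lt_negLogThetaPerImageNonarch_of_not_room_mixed H hH hp₀T hp₀ hp2 i₁ e₁
    (fun b => he (e₁ b)) (hv i₁ e₁) S he2 hfS (fun b hb => hfix (e₁ b) (hfS b hb) (hbS b hb)) hnot (hHfac i₁ e₁)
  rw [hEq] at hlt
  exact lt_irrefl _ hlt

/-- **ONE TAME SUPPORT PRIME OF ODD LOCAL DEGREE `≥ 3`: all-room ⟹ summand identity (mod `JannsenWingbergMappingClass`).**  At a prime `p > 2` over which
every place of the section is tame of odd local degree `≥ 3`, with a valuation family, a bit oracle correct at the residue-degree-one places, and `H_p ≤ indTwo`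
containing the single-factor strip moves and factorwise: if EVERY collection has room at its twisted slot, the guarded `p`-summand of the Θ-side over `H`
equals `negLogThetaPerImageLoc I p` (p588176 §1, ⟸). [claim: Mochizuki2012, status: disputed]
[cite: Mochizuki2012, IUTchIII Cor. 3.12 proof Step (x) p. 181, Step (xi) p. 183] [cite: DupuyHilado2025, Def. 3.6.3, §4.9, §4.12] -/
theorem dif_lnνLp_hull_orbitH_eq_negLogThetaPerImageLoc_of_forall_room_of_jannsenWingbergMappingClass
    (hMC : JannsenWingbergMappingClass) {p : ℕ} (hp : p.Prime) (hp2 : 2 < p)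
    (he : haveI : Fact p.Prime := ⟨hp⟩; ∀ w : placesOver F₀ p, absRamificationIdx p ((I.σ.localFields p).k w) ≤ p - 2)
    (h3 : haveI : Fact p.Prime := ⟨hp⟩; ∀ w : placesOver F₀ p, 3 ≤ localDeg K (I.σ.lift w.1))
    (hodd : haveI : Fact p.Prime := ⟨hp⟩; ∀ w : placesOver F₀ p, Odd (localDeg K (I.σ.lift w.1)))
    (v : (i : Fin I.lstar) → (Fin ((i : ℕ) + 1 + 1) → placesOver F₀ p) → ℤ)
    (hv : haveI : Fact p.Prime := ⟨hp⟩; ∀ (i : Fin I.lstar) (e : Fin ((i : ℕ) + 1 + 1) → placesOver F₀ p),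
      ‖(I.tΘ p hp i (e (Fin.last _)) : (I.σ.localFieldFamily p hp).k (e (Fin.last _)))‖ =
        (p : ℝ) ^ (-(v i e / (absRamificationIdx p ((I.σ.localFields p).k (e (Fin.last _))) : ℝ))))
    (bit : placesOver F₀ p → Prop) [DecidablePred bit]
    (hbit : haveI : Fact p.Prime := ⟨hp⟩; ∀ w : placesOver F₀ p, (I.σ.lift w.1).asIdeal.inertiaDeg ℤ = 1 → bit w →
      ∃ ψ ∈ ind1StripOf (I.σ.lift w.1) (galoisLog (I.σ.lift w.1)),
        RescaledCompletion.of K p (I.σ.lift w.1) (I.σ.natCast_mem_lift w) (ψ (p : (I.σ.lift w.1).adicCompletion K)) -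
            (p : RescaledCompletion K p (I.σ.lift w.1) (I.σ.natCast_mem_lift w)) ∉
          (p : ℚ_[p]) • logUnits (RescaledCompletion K p (I.σ.lift w.1) (I.σ.natCast_mem_lift w)))
    (hfix : haveI : Fact p.Prime := ⟨hp⟩; ∀ w : placesOver F₀ p, (I.σ.lift w.1).asIdeal.inertiaDeg ℤ = 1 → ¬ bit w →
      ∀ ψ ∈ ind1StripOf (I.σ.lift w.1) (galoisLog (I.σ.lift w.1)),
        RescaledCompletion.of K p (I.σ.lift w.1) (I.σ.natCast_mem_lift w) (ψ (p : (I.σ.lift w.1).adicCompletion K)) -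
            (p : RescaledCompletion K p (I.σ.lift w.1) (I.σ.natCast_mem_lift w)) ∈
          (p : ℚ_[p]) • logUnits (RescaledCompletion K p (I.σ.lift w.1) (I.σ.natCast_mem_lift w)))
    (H : haveI : Fact p.Prime := ⟨hp⟩
      (j : ℕ) → (e : Fin (j + 1) → placesOver F₀ p) →
        Subgroup (PacketAlgebra p (fun b => (I.σ.localFields p).k (e b)) ≃ₗ[ℚ_[p]]
          PacketAlgebra p (fun b => (I.σ.localFields p).k (e b))))
    (hH : haveI : Fact p.Prime := ⟨hp⟩; ∀ j e, H j e ≤ indTwo p (fun b => (I.σ.localFields p).k (e b)))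
    (hstrip : haveI : Fact p.Prime := ⟨hp⟩
      ∀ (i : Fin I.lstar) (e : Fin ((i : ℕ) + 1 + 1) → placesOver F₀ p) (b₀ : Fin ((i : ℕ) + 1 + 1)),
        ∀ ψ ∈ ind1StripOf (I.σ.lift (e b₀).1) (galoisLog (I.σ.lift (e b₀).1)), ∃ γ ∈ H ((i : ℕ) + 1) e,
          ∀ z : ∀ b, (I.σ.localFields p).k (e b),
            (γ : PacketAlgebra p (fun b => (I.σ.localFields p).k (e b)) ≃ₗ[ℚ_[p]]
                PacketAlgebra p (fun b => (I.σ.localFields p).k (e b))) (PiTensorProduct.tprod ℚ_[p] z) =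
              PiTensorProduct.tprod ℚ_[p] (update z b₀
                (RescaledCompletion.of K p (I.σ.lift (e b₀).1) (I.σ.natCast_mem_lift (e b₀))
                  (ψ ((RescaledCompletion.of K p (I.σ.lift (e b₀).1) (I.σ.natCast_mem_lift (e b₀))).symm (z b₀))))))
    (hHfac : haveI : Fact p.Prime := ⟨hp⟩
      ∀ (i : Fin I.lstar) (e : Fin ((i : ℕ) + 1 + 1) → placesOver F₀ p), ∀ γ ∈ H ((i : ℕ) + 1) e,
        ∃ δ : Π b, AddAut ((I.σ.lift (e b).1).adicCompletion K),
          (∀ b, δ b ∈ AddSubgroup.closure (G := AddAut ((I.σ.lift (e b).1).adicCompletion K))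
            (ind1StripOf (I.σ.lift (e b).1) (galoisLog (I.σ.lift (e b).1)))) ∧
          ∀ z : Π b, (I.σ.localFields p).k (e b),
            (γ : PacketAlgebra p (fun b => (I.σ.localFields p).k (e b)) ≃ₗ[ℚ_[p]]
                PacketAlgebra p (fun b => (I.σ.localFields p).k (e b))) (PiTensorProduct.tprod ℚ_[p] z) =
              PiTensorProduct.tprod ℚ_[p] (fun b => RescaledCompletion.of K p (I.σ.lift (e b).1) (I.σ.natCast_mem_lift (e b))
                (δ b ((RescaledCompletion.of K p (I.σ.lift (e b).1) (I.σ.natCast_mem_lift (e b))).symm (z b)))))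
    (hroom : haveI : Fact p.Prime := ⟨hp⟩; ∀ (i : Fin I.lstar) (e : Fin ((i : ℕ) + 1 + 1) → placesOver F₀ p),
      (((v i e - 1) % (absRamificationIdx p ((I.σ.localFields p).k (e (Fin.last _))) : ℤ) + 1 : ℤ) : ℝ) /
          (absRamificationIdx p ((I.σ.localFields p).k (e (Fin.last _))) : ℝ) +
        ∑ b ∈ Finset.univ \ Finset.univ.filter (fun b => (I.σ.lift (e b).1).asIdeal.inertiaDeg ℤ ≠ 1 ∨ bit (e b)),
          (1 : ℝ) / (absRamificationIdx p ((I.σ.localFields p).k (e b)) : ℝ) ≤ 1) :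
    (if hp' : p.Prime then
        (haveI : Fact p.Prime := ⟨hp'⟩
        (I.packetAt p hp').lnνLp I.lstar (fun j e =>
          packetHull p (fun b => (I.σ.localFields p).k (e b))
            (⋃ g : H j e, (g : PacketAlgebra p (fun b => (I.σ.localFields p).k (e b)) ≃ₗ[ℚ_[p]]
                PacketAlgebra p (fun b => (I.σ.localFields p).k (e b))) ''
              (I.packetAt p hp').pilotRegion (I.tΘ p hp') j e))) else 0) =
      I.negLogThetaPerImageLoc p := by
  rw [dif_pos hp]
  exact (I.lnνLp_hull_orbitH_eq_negLogThetaPerImageLoc_iff_forall_room_of_jannsenWingbergMappingClass hMC hp hp2 he h3 hodd v hv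
    bit hbit hfix H hH hstrip hHfac).mpr hroom

/-- **LOCALISATION OF THE GLOBAL IDENTITY (mod `JannsenWingbergMappingClass`).**  Let `P ⊆ T(I)` be a set of support primes `> 2` over each of which every
place of the section is tame of odd local degree `≥ 3` (valuation families, bit oracles, `H_p ≤ indTwo` with the strip moves, factorwise), and let EVERY
collection over EVERY `p ∈ P` have room.  Then the GLOBAL identity «nonarchimedean Θ-side over `H` = `−|log(Θ)|^{(P),nonarch}`» holds iff the guarded summand
identity holds at every RESIDUAL support prime `p ∈ T(I) \ P` — a set containing `2` (`two_mem_supportPrimes`, `hP2`), the wild support primes and those with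
a place of even or small local degree.  Nothing is claimed about those summands. [claim: Mochizuki2012, status: disputed]
[cite: Mochizuki2012, IUTchIII Cor. 3.12 proof Step (x) p. 181; IUTchIV Thm. 1.10 Steps (vi)/(viii) pp. 29–31] [cite: DupuyHilado2025, §1 (1.1), §3.9, Def. 3.6.3, §4.12] -/
theorem sum_lnνLp_hull_orbitH_eq_negLogThetaPerImageNonarch_iff_forall_eq_sdiff_of_forall_room_of_jannsenWingbergMappingClass
    (hMC : JannsenWingbergMappingClass)
    (H : ∀ (p : ℕ) (hp : p.Prime), haveI : Fact p.Prime := ⟨hp⟩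
      (j : ℕ) → (e : Fin (j + 1) → placesOver F₀ p) →
        Subgroup (PacketAlgebra p (fun b => (I.σ.localFields p).k (e b)) ≃ₗ[ℚ_[p]]
          PacketAlgebra p (fun b => (I.σ.localFields p).k (e b))))
    (hH : ∀ (p : ℕ) (hp : p.Prime), haveI : Fact p.Prime := ⟨hp⟩; ∀ j e, H p hp j e ≤ indTwo p (fun b => (I.σ.localFields p).k (e b)))
    (P : Finset ℕ) (hPT : P ⊆ I.supportPrimes) (hP2 : ∀ p ∈ P, 2 < p)
    (he : ∀ p ∈ P, ∀ hp : p.Prime, haveI : Fact p.Prime := ⟨hp⟩; ∀ w : placesOver F₀ p, absRamificationIdx p ((I.σ.localFields p).k w) ≤ p - 2)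
    (h3 : ∀ p ∈ P, ∀ w : placesOver F₀ p, 3 ≤ localDeg K (I.σ.lift w.1))
    (hodd : ∀ p ∈ P, ∀ w : placesOver F₀ p, Odd (localDeg K (I.σ.lift w.1)))
    (v : (p : ℕ) → (i : Fin I.lstar) → (Fin ((i : ℕ) + 1 + 1) → placesOver F₀ p) → ℤ)
    (hv : ∀ p ∈ P, ∀ hp : p.Prime, haveI : Fact p.Prime := ⟨hp⟩; ∀ (i : Fin I.lstar) (e : Fin ((i : ℕ) + 1 + 1) → placesOver F₀ p),
      ‖(I.tΘ p hp i (e (Fin.last _)) : (I.σ.localFieldFamily p hp).k (e (Fin.last _)))‖ =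
        (p : ℝ) ^ (-(v p i e / (absRamificationIdx p ((I.σ.localFields p).k (e (Fin.last _))) : ℝ))))
    (bit : (p : ℕ) → placesOver F₀ p → Prop) [∀ p, DecidablePred (bit p)]
    (hbit : ∀ p ∈ P, ∀ hp : p.Prime, haveI : Fact p.Prime := ⟨hp⟩; ∀ w : placesOver F₀ p, (I.σ.lift w.1).asIdeal.inertiaDeg ℤ = 1 → bit p w →
      ∃ ψ ∈ ind1StripOf (I.σ.lift w.1) (galoisLog (I.σ.lift w.1)),
        RescaledCompletion.of K p (I.σ.lift w.1) (I.σ.natCast_mem_lift w) (ψ (p : (I.σ.lift w.1).adicCompletion K)) -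
            (p : RescaledCompletion K p (I.σ.lift w.1) (I.σ.natCast_mem_lift w)) ∉
          (p : ℚ_[p]) • logUnits (RescaledCompletion K p (I.σ.lift w.1) (I.σ.natCast_mem_lift w)))
    (hfix : ∀ p ∈ P, ∀ hp : p.Prime, haveI : Fact p.Prime := ⟨hp⟩; ∀ w : placesOver F₀ p, (I.σ.lift w.1).asIdeal.inertiaDeg ℤ = 1 → ¬ bit p w →
      ∀ ψ ∈ ind1StripOf (I.σ.lift w.1) (galoisLog (I.σ.lift w.1)),
        RescaledCompletion.of K p (I.σ.lift w.1) (I.σ.natCast_mem_lift w) (ψ (p : (I.σ.lift w.1).adicCompletion K)) -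
            (p : RescaledCompletion K p (I.σ.lift w.1) (I.σ.natCast_mem_lift w)) ∈
          (p : ℚ_[p]) • logUnits (RescaledCompletion K p (I.σ.lift w.1) (I.σ.natCast_mem_lift w)))
    (hstrip : ∀ p ∈ P, ∀ hp : p.Prime, haveI : Fact p.Prime := ⟨hp⟩
      ∀ (i : Fin I.lstar) (e : Fin ((i : ℕ) + 1 + 1) → placesOver F₀ p) (b₀ : Fin ((i : ℕ) + 1 + 1)),
        ∀ ψ ∈ ind1StripOf (I.σ.lift (e b₀).1) (galoisLog (I.σ.lift (e b₀).1)), ∃ γ ∈ H p hp ((i : ℕ) + 1) e,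
          ∀ z : ∀ b, (I.σ.localFields p).k (e b),
            (γ : PacketAlgebra p (fun b => (I.σ.localFields p).k (e b)) ≃ₗ[ℚ_[p]]
                PacketAlgebra p (fun b => (I.σ.localFields p).k (e b))) (PiTensorProduct.tprod ℚ_[p] z) =
              PiTensorProduct.tprod ℚ_[p] (update z b₀
                (RescaledCompletion.of K p (I.σ.lift (e b₀).1) (I.σ.natCast_mem_lift (e b₀))
                  (ψ ((RescaledCompletion.of K p (I.σ.lift (e b₀).1) (I.σ.natCast_mem_lift (e b₀))).symm (z b₀))))))
    (hHfac : ∀ p ∈ P, ∀ hp : p.Prime, haveI : Fact p.Prime := ⟨hp⟩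
      ∀ (i : Fin I.lstar) (e : Fin ((i : ℕ) + 1 + 1) → placesOver F₀ p), ∀ γ ∈ H p hp ((i : ℕ) + 1) e,
        ∃ δ : Π b, AddAut ((I.σ.lift (e b).1).adicCompletion K),
          (∀ b, δ b ∈ AddSubgroup.closure (G := AddAut ((I.σ.lift (e b).1).adicCompletion K))
            (ind1StripOf (I.σ.lift (e b).1) (galoisLog (I.σ.lift (e b).1)))) ∧
          ∀ z : Π b, (I.σ.localFields p).k (e b),
            (γ : PacketAlgebra p (fun b => (I.σ.localFields p).k (e b)) ≃ₗ[ℚ_[p]]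
                PacketAlgebra p (fun b => (I.σ.localFields p).k (e b))) (PiTensorProduct.tprod ℚ_[p] z) =
              PiTensorProduct.tprod ℚ_[p] (fun b => RescaledCompletion.of K p (I.σ.lift (e b).1) (I.σ.natCast_mem_lift (e b))
                (δ b ((RescaledCompletion.of K p (I.σ.lift (e b).1) (I.σ.natCast_mem_lift (e b))).symm (z b)))))
    (hroom : ∀ p ∈ P, ∀ hp : p.Prime, haveI : Fact p.Prime := ⟨hp⟩; ∀ (i : Fin I.lstar) (e : Fin ((i : ℕ) + 1 + 1) → placesOver F₀ p),
      (((v p i e - 1) % (absRamificationIdx p ((I.σ.localFields p).k (e (Fin.last _))) : ℤ) + 1 : ℤ) : ℝ) /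
          (absRamificationIdx p ((I.σ.localFields p).k (e (Fin.last _))) : ℝ) +
        ∑ b ∈ Finset.univ \ Finset.univ.filter (fun b => (I.σ.lift (e b).1).asIdeal.inertiaDeg ℤ ≠ 1 ∨ bit p (e b)),
          (1 : ℝ) / (absRamificationIdx p ((I.σ.localFields p).k (e b)) : ℝ) ≤ 1) :
    (∑ p ∈ I.supportPrimes, if hp : p.Prime then
        (haveI : Fact p.Prime := ⟨hp⟩
        (I.packetAt p hp).lnνLp I.lstar (fun j e =>
          packetHull p (fun b => (I.σ.localFields p).k (e b))
            (⋃ g : H p hp j e, (g : PacketAlgebra p (fun b => (I.σ.localFields p).k (e b)) ≃ₗ[ℚ_[p]]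
                PacketAlgebra p (fun b => (I.σ.localFields p).k (e b))) ''
              (I.packetAt p hp).pilotRegion (I.tΘ p hp) j e))) else 0) =
      I.negLogThetaPerImageNonarch ↔
    ∀ p ∈ I.supportPrimes \ P, (if hp : p.Prime then
        (haveI : Fact p.Prime := ⟨hp⟩
        (I.packetAt p hp).lnνLp I.lstar (fun j e =>
          packetHull p (fun b => (I.σ.localFields p).k (e b))
            (⋃ g : H p hp j e, (g : PacketAlgebra p (fun b => (I.σ.localFields p).k (e b)) ≃ₗ[ℚ_[p]]
                PacketAlgebra p (fun b => (I.σ.localFields p).k (e b))) ''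
              (I.packetAt p hp).pilotRegion (I.tΘ p hp) j e))) else 0) =
      I.negLogThetaPerImageLoc p := by
  rw [I.sum_lnνLp_hull_orbitH_eq_negLogThetaPerImageNonarch_iff_forall_eq H hH]
  refine ⟨fun h p hp => h p (Finset.mem_sdiff.mp hp).1, fun h p hpT => ?_⟩
  by_cases hpP : p ∈ P
  · have hp : p.Prime := I.prime_of_mem_supportPrimes (hPT hpP)
    exact I.dif_lnνLp_hull_orbitH_eq_negLogThetaPerImageLoc_of_forall_room_of_jannsenWingbergMappingClass hMC hp (hP2 p hpP) (he p hpP hp)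
      (h3 p hpP) (hodd p hpP) (v p) (hv p hpP hp) (bit p) (hbit p hpP hp) (hfix p hpP hp) (H p hp) (hH p hp) (hstrip p hpP hp)
      (hHfac p hpP hp) (hroom p hpP hp)
  · exact h p (Finset.mem_sdiff.mpr ⟨hpT, hpP⟩)

/-- **The residual set always contains `2`.**  For a prime set `P` of primes `> 2`, `2 ∈ T(I) \ P` (`two_mem_supportPrimes`): the localisation above never
empties the residual side. [cite: Mochizuki2012, IUTchIV Thm. 1.10 Step (vi) p. 29] [cite: DupuyHilado2025, §3.9] -/
theorem two_mem_supportPrimes_sdiff (P : Finset ℕ) (hP2 : ∀ p ∈ P, 2 < p) : 2 ∈ I.supportPrimes \ P :=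
  Finset.mem_sdiff.mpr ⟨I.two_mem_supportPrimes, fun h => lt_irrefl 2 (hP2 2 h)⟩

/-- **CLAIM FORMS ON THE IDENTITY LOCUS.**  Where the nonarchimedean Θ-side over `H` EQUALS `−|log(Θ)|^{(P),nonarch}`, «Cor 3.12's nonarchimedean (P)-form
over `H`» (`−|log(q)| ≤` the `H`-sum) and abc-iut-S2's Dupuy–Hilado form `Cor312PerImageNonarchOf I` are the SAME inequality (with p588683 §4: equivalent ON
the locus, the `H`-form a tighter bound OFF it).  Bookkeeping between two `Prop`s; neither is asserted. [claim: Mochizuki2012, status: disputed]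
[cite: Mochizuki2012, IUTchIII Cor. 3.12 pp. 173–174, Step (x) p. 181] [cite: DupuyHilado2025, §1 (1.1)] -/
theorem negAbsLogQ_le_sum_iff_cor312PerImageNonarchOf_of_sum_eq
    (H : ∀ (p : ℕ) (hp : p.Prime), haveI : Fact p.Prime := ⟨hp⟩
      (j : ℕ) → (e : Fin (j + 1) → placesOver F₀ p) →
        Subgroup (PacketAlgebra p (fun b => (I.σ.localFields p).k (e b)) ≃ₗ[ℚ_[p]]
          PacketAlgebra p (fun b => (I.σ.localFields p).k (e b))))
    (hEq : (∑ p ∈ I.supportPrimes, if hp : p.Prime then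
        (haveI : Fact p.Prime := ⟨hp⟩
        (I.packetAt p hp).lnνLp I.lstar (fun j e =>
          packetHull p (fun b => (I.σ.localFields p).k (e b))
            (⋃ g : H p hp j e, (g : PacketAlgebra p (fun b => (I.σ.localFields p).k (e b)) ≃ₗ[ℚ_[p]]
                PacketAlgebra p (fun b => (I.σ.localFields p).k (e b))) ''
              (I.packetAt p hp).pilotRegion (I.tΘ p hp) j e))) else 0) =
      I.negLogThetaPerImageNonarch) :
    (I.negAbsLogQ ≤ ∑ p ∈ I.supportPrimes, if hp : p.Prime then
        (haveI : Fact p.Prime := ⟨hp⟩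
        (I.packetAt p hp).lnνLp I.lstar (fun j e =>
          packetHull p (fun b => (I.σ.localFields p).k (e b))
            (⋃ g : H p hp j e, (g : PacketAlgebra p (fun b => (I.σ.localFields p).k (e b)) ≃ₗ[ℚ_[p]]
                PacketAlgebra p (fun b => (I.σ.localFields p).k (e b))) ''
              (I.packetAt p hp).pilotRegion (I.tΘ p hp) j e))) else 0) ↔
      I.Cor312PerImageNonarchOf := by
  rw [hEq]
  rfl

end Literature.IUT.LogVolume.ThetaVolumeInput

end
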